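import Summits.CriticalPhenomena.SAWScalingLimit.Theses.SAWRenewalTightness
import Summits.CriticalPhenomena.SAWScalingLimit.Theorems.SubseqIdentification.Negative.CoincidentEndpointLaw
import Literature.Probability.Percolation.QuadCrossingSquareModel
import Literature.Probability.RandomPlanarGeometry.RectangleConformalMap
import Literature.Probability.RandomPlanarGeometry.PlanarDomains
import Literature.Probability.LatticeModels.DomainDiscretisation

/-!
# `stub_referenceWindow`: a reference Dobrushin domain with a flat lattice wall

Stub S2 `stub_referenceWindow` of the line `boundary-area-law` for the crux `SubseqIdentification`
(stmt-CriticalPhenomena-0783, route `SAWRenewalTightness`; shared decl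
`Summit.CriticalPhenomena.SAWScalingLimit.Theses.SAWRenewalTightness.SubseqIdentification`).

We build ONE concrete Dobrushin domain with an honest endpoint approximation and a flat,
axis-parallel (horizontal) wall window:

* `D₀` is the open square `(-1, 1)²` (tree: `symRectQuad 1 1`, carrier `symRect 1 1`, boundary the
  closed polygon through the four corners) with the two BOTTOM corners marked,
  `a = D₀.pt 0 = (-1, -1)` and `b = D₀.pt 1 = (1, -1)` (`MarkedDomain.chord 0 1` of the
  four-marked square; the corners are vertices of `polygonLoop (rectVerts 1 1)`,
  `polygonLoop_vertex`);
* `a₀ δ = (-(⌈δ⁻¹⌉ - 1), -(⌈δ⁻¹⌉ - 1))`, `b₀ δ = (⌈δ⁻¹⌉ - 1, -(⌈δ⁻¹⌉ - 1))`: their mesh points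
  are `(∓t, -t)` with `t = δ (⌈δ⁻¹⌉ - 1) ∈ [1 - δ, 1)` (`Negative.near_bounds`), so they lie in
  the OPEN square for `0 < δ < 2`, are within `2δ` of the two corners, and are joined inside
  `Ω_δ`: the mesh-vertex graph of the square is connected (walk to the origin decreasing
  `|x₀| + |x₁|` coordinatewise, as for the disc in `Negative.CoincidentEndpointLaw`), so
  `Ω_δ = δℤ² ∩ (-1, 1)²` and any two of its sites are `discreteDomainGraph`-reachable;
* `x₀ = -i` (the bottom mid-point, not a corner) and `ρ₀ = 1/2`: inside `B(-i, 1/2)` one has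
  `|Re z| < 1/2` and `Im z < -1/2`, so `z ∈ (-1, 1)²` iff `Im z > -1 = Im x₀`.

No named fact is used; axioms `propext`, `Classical.choice`, `Quot.sound`.
-/

noncomputable section

open MeasureTheory Filter Topology Set
open scoped NNReal ENNReal

namespace Summit.CriticalPhenomena.SAWScalingLimit.Theorems.SubseqIdentification.BoundaryAreaLaw

open Literature.Probability.RandomPlanarGeometry Literature.Probability.LatticeModels
open Literature.Probability.Percolation (symRectQuad symRectQuad_carrier quarterMarks
  quarterMarks_apply)
open Summit.CriticalPhenomena.SAWScalingLimit.Theorems.SubseqIdentification.Negative (near_bounds)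

/-! ### The mesh graph of an open rectangle is connected -/

/-- A lattice point that is coordinatewise at least as close to the axes as a mesh vertex of the
rectangle `(-a, a) × (-b, b)` is again a mesh vertex of it. [folklore] -/
theorem meshPoint_mem_symRect_of_natAbs_le {a b δ : ℝ} {x y : Site 2}
    (hx : meshPoint δ x ∈ symRect a b) (h0 : (y 0).natAbs ≤ (x 0).natAbs)
    (h1 : (y 1).natAbs ≤ (x 1).natAbs) : meshPoint δ y ∈ symRect a b := by
  rw [mem_symRect, meshPoint_re, meshPoint_im] at hx ⊢
  obtain ⟨⟨h0a, h0b⟩, h1a, h1b⟩ := hx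
  have h0' : |(y 0 : ℝ)| ≤ |(x 0 : ℝ)| := by
    have := (Nat.cast_le (α := ℝ)).2 h0
    simpa only [Nat.cast_natAbs, Int.cast_abs] using this
  have h1' : |(y 1 : ℝ)| ≤ |(x 1 : ℝ)| := by
    have := (Nat.cast_le (α := ℝ)).2 h1
    simpa only [Nat.cast_natAbs, Int.cast_abs] using this
  have hx0 : |δ * (x 0 : ℝ)| < a := abs_lt.2 ⟨h0a, h0b⟩
  have hx1 : |δ * (x 1 : ℝ)| < b := abs_lt.2 ⟨h1a, h1b⟩
  have hy0 : |δ * (y 0 : ℝ)| < a := by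
    rw [abs_mul] at hx0 ⊢
    exact (mul_le_mul_of_nonneg_left h0' (abs_nonneg δ)).trans_lt hx0
  have hy1 : |δ * (y 1 : ℝ)| < b := by
    rw [abs_mul] at hx1 ⊢
    exact (mul_le_mul_of_nonneg_left h1' (abs_nonneg δ)).trans_lt hx1
  exact ⟨abs_lt.1 hy0, abs_lt.1 hy1⟩

/-- One lattice step towards the origin: it changes one coordinate, moving it towards `0`, so both
`|x₀|`, `|x₁|` are non-increasing and `|x₀| + |x₁|` decreases. [folklore] -/
theorem exists_step_natAbs (x : Site 2) (hx : x ≠ 0) :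
    ∃ y : Site 2, (zdGraph 2).Adj x y ∧ (y 0).natAbs ≤ (x 0).natAbs ∧
      (y 1).natAbs ≤ (x 1).natAbs ∧ (y 0).natAbs + (y 1).natAbs < (x 0).natAbs + (x 1).natAbs := by
  by_cases h0 : x 0 = 0
  · have h1 : x 1 ≠ 0 := by
      intro h1; apply hx; funext i; fin_cases i <;> simp [h0, h1]
    rcases lt_or_gt_of_ne h1 with hneg | hpos
    · refine ⟨x + Pi.single 1 1, (zdGraph_adj_iff _ _).2 ⟨1, Or.inl rfl⟩, ?_, ?_, ?_⟩ <;>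
        simp only [Pi.add_apply, Pi.single_eq_same, Pi.single_eq_of_ne (zero_ne_one),
          add_zero] <;> omega
    · refine ⟨x - Pi.single 1 1, (zdGraph_adj_iff _ _).2 ⟨1, Or.inr (by simp)⟩, ?_, ?_, ?_⟩ <;>
        simp only [Pi.sub_apply, Pi.single_eq_same, Pi.single_eq_of_ne (zero_ne_one),
          sub_zero] <;> omega
  · rcases lt_or_gt_of_ne h0 with hneg | hpos
    · refine ⟨x + Pi.single 0 1, (zdGraph_adj_iff _ _).2 ⟨0, Or.inl rfl⟩, ?_, ?_, ?_⟩ <;>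
        simp only [Pi.add_apply, Pi.single_eq_same, Pi.single_eq_of_ne (one_ne_zero),
          add_zero] <;> omega
    · refine ⟨x - Pi.single 0 1, (zdGraph_adj_iff _ _).2 ⟨0, Or.inr (by simp)⟩, ?_, ?_, ?_⟩ <;>
        simp only [Pi.sub_apply, Pi.single_eq_same, Pi.single_eq_of_ne (one_ne_zero),
          sub_zero] <;> omega

/-- The origin is a mesh vertex of the rectangle at every mesh. [folklore] -/
theorem zero_mem_meshVertices_symRect {a b : ℝ} (ha : 0 < a) (hb : 0 < b) (δ : ℝ) :
    (0 : Site 2) ∈ meshVertices (symRect a b) δ := by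
  have h0 : meshPoint δ (0 : Site 2) = 0 := Complex.ext (by simp) (by simp)
  rw [mem_meshVertices_iff, h0]
  exact zero_mem_symRect ha hb

/-- Neighbouring lattice points of the rectangle are joined in its mesh graph (convexity).
[folklore] -/
theorem meshGraph_symRect_adj {a b δ : ℝ} {x y : Site 2} (hxy : (zdGraph 2).Adj x y)
    (hx : meshPoint δ x ∈ symRect a b) (hy : meshPoint δ y ∈ symRect a b) :
    (meshGraph (symRect a b) δ).Adj x y :=
  meshGraph_adj_iff.2 ⟨hxy, ((convex_symRect a b).segment_subset hx hy).trans subset_closure⟩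

/-- Every mesh vertex of the rectangle is joined to the origin inside the mesh vertex graph.
[folklore] -/
theorem reachable_zero_symRect {a b : ℝ} (ha : 0 < a) (hb : 0 < b) (δ : ℝ) :
    ∀ (n : ℕ) (x : Site 2) (hx : x ∈ meshVertices (symRect a b) δ),
      (x 0).natAbs + (x 1).natAbs = n →
      (meshVertexGraph (symRect a b) δ).Reachable ⟨x, hx⟩
        ⟨0, zero_mem_meshVertices_symRect ha hb δ⟩ := by
  intro n
  induction n using Nat.strong_induction_on with
  | _ n ih =>
    intro x hx hn
    by_cases h0 : x = 0
    · subst h0; rfl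
    obtain ⟨y, hadj, hy0, hy1, hlt⟩ := exists_step_natAbs x h0
    have hy : y ∈ meshVertices (symRect a b) δ := meshPoint_mem_symRect_of_natAbs_le hx hy0 hy1
    have h1 : (meshVertexGraph (symRect a b) δ).Adj ⟨x, hx⟩ ⟨y, hy⟩ := by
      simp only [SimpleGraph.comap_adj, Function.Embedding.subtype_apply]
      exact meshGraph_symRect_adj hadj hx hy
    exact h1.reachable.trans (ih _ (hn ▸ hlt) y hy rfl)

/-- The mesh vertex graph of the rectangle is preconnected at every mesh. [folklore] -/
theorem meshVertexGraph_symRect_preconnected {a b : ℝ} (ha : 0 < a) (hb : 0 < b) (δ : ℝ) :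
    (meshVertexGraph (symRect a b) δ).Preconnected := fun u v =>
  (reachable_zero_symRect ha hb δ _ u.1 u.2 rfl).trans
    (reachable_zero_symRect ha hb δ _ v.1 v.2 rfl).symm

/-- For the rectangle, `Ω_δ` is all of `δℤ² ∩ (-a, a) × (-b, b)` (one component only).
[folklore] -/
theorem mem_meshDomain_symRect {a b : ℝ} (ha : 0 < a) (hb : 0 < b) {δ : ℝ} {x : Site 2}
    (hx : x ∈ meshVertices (symRect a b) δ) : x ∈ meshDomain (symRect a b) δ := by
  have hsub := (meshVertexGraph_symRect_preconnected ha hb δ).subsingleton_connectedComponent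
  simp only [meshDomain, Set.mem_iUnion, Set.mem_image]
  refine ⟨(meshVertexGraph (symRect a b) δ).connectedComponentMk ⟨x, hx⟩, fun C' => ?_, ⟨x, hx⟩,
    ?_, rfl⟩
  · rw [Subsingleton.elim C' ((meshVertexGraph (symRect a b) δ).connectedComponentMk ⟨x, hx⟩)]
  · rw [SimpleGraph.ConnectedComponent.mem_supp_iff]

/-- Any two lattice points of the rectangle are joined in `Ω_δ`. [folklore] -/
theorem reachable_symRect {a b : ℝ} (ha : 0 < a) (hb : 0 < b) {δ : ℝ} {x y : Site 2}
    (hx : meshPoint δ x ∈ symRect a b) (hy : meshPoint δ y ∈ symRect a b) :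
    (discreteDomainGraph (symRect a b) δ).Reachable x y := by
  let hom : meshVertexGraph (symRect a b) δ →g discreteDomainGraph (symRect a b) δ :=
    { toFun := Subtype.val
      map_rel' := fun {u v} h =>
        discreteDomainGraph_adj_iff.2
          ⟨h, mem_meshDomain_symRect ha hb u.2, mem_meshDomain_symRect ha hb v.2⟩ }
  exact (meshVertexGraph_symRect_preconnected ha hb δ ⟨x, hx⟩ ⟨y, hy⟩).map hom

/-! ### The honest corner approximations of the square `(-1, 1)²` -/

/-- The mesh point of the bottom-left corner approximation is `(-t, -t)`, `t = δ (⌈δ⁻¹⌉ - 1)`.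
[folklore] -/
theorem meshPoint_cornerA (δ : ℝ) :
    meshPoint δ ![-(⌈δ⁻¹⌉ - 1), -(⌈δ⁻¹⌉ - 1)] =
      ⟨-(δ * ((⌈δ⁻¹⌉ - 1 : ℤ) : ℝ)), -(δ * ((⌈δ⁻¹⌉ - 1 : ℤ) : ℝ))⟩ :=
  Complex.ext (by simp; ring) (by simp; ring)

/-- The mesh point of the bottom-right corner approximation is `(t, -t)`, `t = δ (⌈δ⁻¹⌉ - 1)`.
[folklore] -/
theorem meshPoint_cornerB (δ : ℝ) :
    meshPoint δ ![⌈δ⁻¹⌉ - 1, -(⌈δ⁻¹⌉ - 1)] =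
      ⟨δ * ((⌈δ⁻¹⌉ - 1 : ℤ) : ℝ), -(δ * ((⌈δ⁻¹⌉ - 1 : ℤ) : ℝ))⟩ :=
  Complex.ext (by simp) (by simp; ring)

/-- The bottom-left corner approximation lies in the open square for `0 < δ < 2`. [folklore] -/
theorem cornerA_mem {δ : ℝ} (hδ : 0 < δ) (hδ2 : δ < 2) :
    meshPoint δ ![-(⌈δ⁻¹⌉ - 1), -(⌈δ⁻¹⌉ - 1)] ∈ symRect 1 1 := by
  obtain ⟨h1, h2⟩ := near_bounds hδ
  rw [meshPoint_cornerA, mem_symRect]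
  exact ⟨⟨by linarith, by linarith⟩, by linarith, by linarith⟩

/-- The bottom-right corner approximation lies in the open square for `0 < δ < 2`. [folklore] -/
theorem cornerB_mem {δ : ℝ} (hδ : 0 < δ) (hδ2 : δ < 2) :
    meshPoint δ ![⌈δ⁻¹⌉ - 1, -(⌈δ⁻¹⌉ - 1)] ∈ symRect 1 1 := by
  obtain ⟨h1, h2⟩ := near_bounds hδ
  rw [meshPoint_cornerB, mem_symRect]
  exact ⟨⟨by linarith, by linarith⟩, by linarith, by linarith⟩

/-- The bottom-left corner approximation is within `2δ` of the corner `(-1, -1)`. [folklore] -/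
theorem dist_cornerA_le {δ : ℝ} (hδ : 0 < δ) :
    dist (meshPoint δ ![-(⌈δ⁻¹⌉ - 1), -(⌈δ⁻¹⌉ - 1)]) ⟨-1, -1⟩ ≤ 2 * δ := by
  obtain ⟨h1, h2⟩ := near_bounds hδ
  rw [meshPoint_cornerA, Complex.dist_eq]
  refine (Complex.norm_le_abs_re_add_abs_im _).trans ?_
  simp only [Complex.sub_re, Complex.sub_im]
  have h : |-(δ * ((⌈δ⁻¹⌉ - 1 : ℤ) : ℝ)) - -1| ≤ δ := abs_le.2 ⟨by linarith, by linarith⟩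
  linarith

/-- The bottom-right corner approximation is within `2δ` of the corner `(1, -1)`. [folklore] -/
theorem dist_cornerB_le {δ : ℝ} (hδ : 0 < δ) :
    dist (meshPoint δ ![⌈δ⁻¹⌉ - 1, -(⌈δ⁻¹⌉ - 1)]) ⟨1, -1⟩ ≤ 2 * δ := by
  obtain ⟨h1, h2⟩ := near_bounds hδ
  rw [meshPoint_cornerB, Complex.dist_eq]
  refine (Complex.norm_le_abs_re_add_abs_im _).trans ?_
  simp only [Complex.sub_re, Complex.sub_im]
  have h : |δ * ((⌈δ⁻¹⌉ - 1 : ℤ) : ℝ) - 1| ≤ δ := abs_le.2 ⟨by linarith, by linarith⟩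
  have h' : |-(δ * ((⌈δ⁻¹⌉ - 1 : ℤ) : ℝ)) - -1| ≤ δ := abs_le.2 ⟨by linarith, by linarith⟩
  linarith

/-- `δ · a₀ δ → (-1, -1)` along `δ → 0⁺`. [folklore] -/
theorem tendsto_meshPoint_cornerA :
    Tendsto (fun δ => meshPoint δ ![-(⌈δ⁻¹⌉ - 1), -(⌈δ⁻¹⌉ - 1)]) (𝓝[>] (0 : ℝ))
      (𝓝 (⟨-1, -1⟩ : ℂ)) := by
  rw [Metric.tendsto_nhds]
  intro ε hε
  filter_upwards [Ioo_mem_nhdsGT (half_pos hε)] with δ hδ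
  exact (dist_cornerA_le hδ.1).trans_lt (by linarith [hδ.2])

/-- `δ · b₀ δ → (1, -1)` along `δ → 0⁺`. [folklore] -/
theorem tendsto_meshPoint_cornerB :
    Tendsto (fun δ => meshPoint δ ![⌈δ⁻¹⌉ - 1, -(⌈δ⁻¹⌉ - 1)]) (𝓝[>] (0 : ℝ))
      (𝓝 (⟨1, -1⟩ : ℂ)) := by
  rw [Metric.tendsto_nhds]
  intro ε hε
  filter_upwards [Ioo_mem_nhdsGT (half_pos hε)] with δ hδ
  exact (dist_cornerB_le hδ.1).trans_lt (by linarith [hδ.2])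

/-! ### The marked corners of the square and the flat window -/

/-- The first marked point of the four-marked square `(-1, 1)²` is the corner `(-1, -1)`.
[folklore] -/
theorem symRectQuad_pt_zero : (symRectQuad 1 1 one_pos one_pos).pt 0 = ⟨-1, -1⟩ := by
  have h := polygonLoop_vertex (l := rectVerts 1 1) (k := 0) (by simp)
  simp only [length_rectVerts, CharP.cast_eq_zero, Nat.cast_ofNat, zero_div] at h
  change polygonLoop (rectVerts 1 1) (quarterMarks 0) = _
  rw [quarterMarks_apply, Fin.val_zero, Nat.cast_zero, zero_div, h]
  simp [rectVerts]

/-- The second marked point of the four-marked square `(-1, 1)²` is the corner `(1, -1)`.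
[folklore] -/
theorem symRectQuad_pt_one : (symRectQuad 1 1 one_pos one_pos).pt 1 = ⟨1, -1⟩ := by
  have h := polygonLoop_vertex (l := rectVerts 1 1) (k := 1) (by simp)
  simp only [length_rectVerts, Nat.cast_one, Nat.cast_ofNat] at h
  change polygonLoop (rectVerts 1 1) (quarterMarks 1) = _
  rw [quarterMarks_apply, Fin.val_one, Nat.cast_one, h]
  simp [rectVerts]

/-- **The flat window**: inside the disc `B(-i, 1/2)` the open square `(-1, 1)²` is the open
upper half-plane `{Im z > -1}`. [folklore] -/
theorem symRect_inter_ball_negI :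
    symRect 1 1 ∩ Metric.ball (-Complex.I) (1 / 2) =
      {z : ℂ | (-Complex.I).im < z.im} ∩ Metric.ball (-Complex.I) (1 / 2) := by
  ext z
  simp only [mem_inter_iff, mem_symRect, Metric.mem_ball, mem_setOf_eq, Complex.neg_im,
    Complex.I_im]
  constructor
  · rintro ⟨⟨-, h, -⟩, hd⟩
    exact ⟨h, hd⟩
  · rintro ⟨h, hd⟩
    have hn : dist z (-Complex.I) = ‖z + Complex.I‖ := by rw [dist_eq_norm, sub_neg_eq_add]
    have hre : |z.re| < 1 / 2 := by
      have := Complex.abs_re_le_norm (z + Complex.I)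
      simp only [Complex.add_re, Complex.I_re, add_zero] at this
      linarith
    have him : |z.im + 1| < 1 / 2 := by
      have := Complex.abs_im_le_norm (z + Complex.I)
      simp only [Complex.add_im, Complex.I_im] at this
      linarith
    obtain ⟨hre1, hre2⟩ := abs_lt.1 hre
    obtain ⟨him1, him2⟩ := abs_lt.1 him
    exact ⟨⟨⟨by linarith, by linarith⟩, h, by linarith⟩, hd⟩

/-! ### The stub -/

/-- **S2 — a reference Dobrushin domain with a flat lattice wall.** There are a Dobrushin domain
`D₀`, an endpoint approximation `(a₀, b₀)` of it (`SAW.IsEndpointApprox`), a point `x₀` and a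
radius `ρ₀ > 0` such that `D₀ ∩ B(x₀, ρ₀)` is the open upper half-disc
`{Im z > Im x₀} ∩ B(x₀, ρ₀)` — a straight horizontal wall through `x₀` — and `x₀` is neither marked
point. Witness: the open square `(-1, 1)²` with its two bottom corners `(-1, -1)`, `(1, -1)` marked
(`(symRectQuad 1 1).chord 0 1`), `a₀ δ = (-(⌈δ⁻¹⌉ - 1), -(⌈δ⁻¹⌉ - 1))`,
`b₀ δ = (⌈δ⁻¹⌉ - 1, -(⌈δ⁻¹⌉ - 1))` (inside the open square for `0 < δ < 2`, within `2δ` of the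
corners, joined in `Ω_δ = δℤ² ∩ (-1, 1)²` because the square's mesh graph is connected),
`x₀ = -i`, `ρ₀ = 1/2`. [folklore] -/
theorem stub_referenceWindow :
    ∃ (D₀ : DobrushinDomain) (a₀ b₀ : ℝ → Site 2) (x₀ : ℂ) (ρ₀ : ℝ),
      SAW.IsEndpointApprox D₀ a₀ b₀ ∧ 0 < ρ₀ ∧ x₀ ≠ D₀.pt 0 ∧ x₀ ≠ D₀.pt 1 ∧
        D₀.carrier ∩ Metric.ball x₀ ρ₀ = {z : ℂ | x₀.im < z.im} ∩ Metric.ball x₀ ρ₀ := by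
  refine ⟨(symRectQuad 1 1 one_pos one_pos).chord 0 1 (by decide),
    fun δ => ![-(⌈δ⁻¹⌉ - 1), -(⌈δ⁻¹⌉ - 1)], fun δ => ![⌈δ⁻¹⌉ - 1, -(⌈δ⁻¹⌉ - 1)], -Complex.I,
    1 / 2, ⟨?_, ?_, ?_⟩, by norm_num, ?_, ?_, ?_⟩
  · -- joined in `Ω_δ` for `δ ∈ (0, 2)`
    filter_upwards [Ioo_mem_nhdsGT (by norm_num : (0 : ℝ) < 2)] with δ hδ
    exact reachable_symRect one_pos one_pos (cornerA_mem hδ.1 hδ.2) (cornerB_mem hδ.1 hδ.2)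
  · rw [MarkedDomain.pt_chord_zero, symRectQuad_pt_zero]
    exact tendsto_meshPoint_cornerA
  · rw [MarkedDomain.pt_chord_one, symRectQuad_pt_one]
    exact tendsto_meshPoint_cornerB
  · rw [MarkedDomain.pt_chord_zero, symRectQuad_pt_zero]
    intro h
    have := congrArg Complex.re h
    norm_num at this
  · rw [MarkedDomain.pt_chord_one, symRectQuad_pt_one]
    intro h
    have := congrArg Complex.re h
    norm_num at this
  · exact symRect_inter_ball_negI

end Summit.CriticalPhenomena.SAWScalingLimit.Theorems.SubseqIdentification.BoundaryAreaLaw
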